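/-
Copyright (c) 2026. All rights reserved.
Released under Apache 2.0 license as described in the file LICENSE.
Authors: HodgeCM publication cell (pub-hodgecm), GR lane, seat GR-2 (`pub-hodgecm-own-hyp34`).
-/
import Literature.NumberTheory.GelbartRogawski1991.Prop311PrintedDarbouxLegsTransport
import Literature.NumberTheory.Weil1964.AdelicMetaplecticProjSurjective
import HarnessLib

-- build-lane note (ops-buildfix G11b-3 recipe): dependent telescopes of the CM dual-pair datum; elaborate sequentially.
set_option Elab.async false

/-!
# [GelbartRogawski1991, Prop. 3.1.1] AS PRINTED: one `Mp` leg over one adelic Darboux frame suffices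

Topic `NumberTheory/GelbartRogawski1991`; namespace `Literature.NumberTheory.GelbartRogawski1991.Prop311`.  KERNEL ONLY:
theorems; nothing of [GelbartRogawski1991] or [Weil1964] is asserted; `Prop311AsPrinted` is untouched.

`Prop311PrintedDarbouxLegs.DarbouxLegs F E V Φ ρ n` — the input predicate to which the frame files reduce the printed
proposition at CM data — asks for a continuous leg `Mp_ψ(𝐀ⁿ × 𝐀ⁿ, std)ᶜᵒⁿᵗ → Mp_𝐀(W)` over EVERY adelic Darboux frame.
`Prop311PrintedDarbouxLegsTransport.darbouxLegs_of_darbouxLeg_of_proj_surjective` moved a leg from one frame to any other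
GIVEN that `π₁ : Mp_ψ(𝐀ⁿ × 𝐀ⁿ, std)ᶜᵒⁿᵗ → Sp(𝐀ⁿ × 𝐀ⁿ, std)` is onto; `AdelicMetaplecticProjSurjective.adelicMpCont.proj_one_surjective`
([Weil1964, Chap. III n° 37]: every adelic symplectic automorphism is implemented, via the Siegel generators of
`Sp_{2n}(𝐀_F)`) discharges that hypothesis.  Hence, hypothesis-free:

* **`darbouxLegs_of_darbouxLeg`**: ONE continuous leg over ONE adelic Darboux frame gives `DarbouxLegs`;
* **`prop311_CM_of_darbouxLeg`**: at CM data, ONE continuous leg over ONE adelic Darboux frame of `φ_𝐀` gives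
  (a) "`π` splits uniquely over `Sp_F(W)`" and (b) clauses (1) ∧ (2) of Prop. 3.1.1 verbatim for every rational splitting
  — the body of `Prop311AsPrinted` at `(L⁺, L, conj)` for the model carrying the leg.

## References
* [GelbartRogawski1991] S. Gelbart, J. Rogawski, Invent. Math. 105 (1991) 445–472, §3.1 p. 454 L17–36, Prop. 3.1.1
  p. 455 L1–2.
* [Weil1964] A. Weil, Acta Math. 111 (1964) 143–211, Chap. III n° 37–40.
-/

set_option autoImplicit false

noncomputable section

open NumberField
open scoped TensorProduct Matrix
open Literature.NumberTheory.Automorphic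
open Literature.RepresentationTheory.HeisenbergGroup
open Literature.NumberTheory.Weil1964

namespace Literature.NumberTheory.GelbartRogawski1991

namespace Prop311

/-! ## §1. One leg gives all the legs -/

section Legs

variable (F : Type) [Field F] [NumberField F]
variable (E : Type) [Field E] [Algebra F E]
variable (V : Type) [AddCommGroup V] [Module F V]
variable (Φ : V →ₗ[F] V →ₗ[F] E)
variable {S : Type} [NormedAddCommGroup S] [InnerProductSpace ℂ S]
variable (ρ : Representation ℂ (AdelicHeisenberg F E V Φ) S)

/-- **ONE continuous `Mp` leg over ONE adelic Darboux frame gives `DarbouxLegs`** (legs over every adelic Darboux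
frame): the frame change `e₀⁻¹ ∘ e ∈ Sp(𝐀ⁿ × 𝐀ⁿ, std)` lifts to `Mp_ψ(𝐀ⁿ × 𝐀ⁿ, std)ᶜᵒⁿᵗ` (`adelicMpCont.proj_one_surjective`,
[Weil1964, Chap. III n° 37]) and conjugation by the image of the lift moves the leg (`exists_darbouxLeg_of_lift`).
[cite: GelbartRogawski1991, §3.1 p. 454 L21–30; Weil1964, Chap. III n° 37–39] -/
theorem darbouxLegs_of_darbouxLeg (n : ℕ)
    (e₀ : ((Fin n → AdeleRing (𝓞 F) F) × (Fin n → AdeleRing (𝓞 F) F)) ≃ₗ[AdeleRing (𝓞 F) F] AdelicSpace F V)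
    (he₀ : ∀ c c' : (Fin n → AdeleRing (𝓞 F) F) × (Fin n → AdeleRing (𝓞 F) F),
      adelicTraceForm F E V Φ (e₀ c) (e₀ c') = c.1 ⬝ᵥ c'.2 - c'.1 ⬝ᵥ c.2)
    (φ₀ : adelicMpCont F (Fin n) (1 : Matrix (Fin n) (Fin n) (AdeleRing (𝓞 F) F)) →* adelicMp F E V Φ ρ)
    (hφ₀ : Continuous φ₀)
    (hproj₀ : ∀ (m₁ : adelicMpCont F (Fin n) (1 : Matrix (Fin n) (Fin n) (AdeleRing (𝓞 F) F)))
        (c : (Fin n → AdeleRing (𝓞 F) F) × (Fin n → AdeleRing (𝓞 F) F)),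
      ((proj F E V Φ ρ (φ₀ m₁) : adelicSp F E V Φ) :
          AdelicSpace F V ≃ₗ[AdeleRing (𝓞 F) F] AdelicSpace F V) (e₀ c) =
        e₀ (((adelicMpCont.proj F (Fin n) (1 : Matrix (Fin n) (Fin n) (AdeleRing (𝓞 F) F)) m₁ :
              symplecticGroup (polar (adelicForm F (Fin n) (1 : Matrix (Fin n) (Fin n) (AdeleRing (𝓞 F) F))))) :
            ((Fin n → AdeleRing (𝓞 F) F) × (Fin n → AdeleRing (𝓞 F) F)) ≃ₗ[AdeleRing (𝓞 F) F]
              ((Fin n → AdeleRing (𝓞 F) F) × (Fin n → AdeleRing (𝓞 F) F))) c)) :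
    DarbouxLegs F E V Φ ρ n :=
  darbouxLegs_of_darbouxLeg_of_proj_surjective F E V Φ ρ n (adelicMpCont.proj_one_surjective F) e₀ he₀ φ₀ hφ₀ hproj₀

end Legs

/-! ## §2. The CM capstone from one leg -/

section CM

variable (L : Type) [Field L] [NumberField L] [IsCMField L]
variable {n : ℕ}
-- `V` an `L`-space; its `L⁺`-structure is Mathlib's restriction (no separate binder).
variable (V : Type) [AddCommGroup V] [Module L V] [FiniteDimensional L V]
variable (Φ : V →ₗ[↥(maximalRealSubfield L)] V →ₗ[↥(maximalRealSubfield L)] L)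
variable {S : Type} [NormedAddCommGroup S] [InnerProductSpace ℂ S] [CompleteSpace S]
variable (ρ : Representation ℂ (AdelicHeisenberg (↥(maximalRealSubfield L)) L V Φ) S)

/-- **[We] + [GelbartRogawski1991, Prop. 3.1.1] AS PRINTED AT CM DATA from ONE leg over ONE adelic Darboux frame.**
`L` a CM field, `F = L⁺`, `E = L`, `σ` = complex conjugation; binders of `Prop311AsPrinted` at these parameters
(`(V, Φ)` skew-Hermitian of `E`-dimension `n`, `φ = Tr Φ` non-degenerate, `ρ` isometric and irreducible); ONE continuous
leg `φ₀ : Mp_ψ(𝐀ⁿ × 𝐀ⁿ, std)ᶜᵒⁿᵗ →* Mp_𝐀(W)` over ONE adelic Darboux frame `e₀` of `φ_𝐀`.  Then (a) `π` has exactly one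
rational splitting `i` ("*`π` splits uniquely over `Sp_F(W)`*", p. 454 L35–36), and (b) for every rational splitting `i`
the conclusion (1) ∧ (2) of Prop. 3.1.1 holds verbatim as rendered in `Prop311AsPrinted`
(`darbouxLegs_of_darbouxLeg` + `prop311_CM_of_darbouxLegs`). [cite: GelbartRogawski1991, §3.1 p. 454 L17–42; Prop. 3.1.1
p. 455 L1–2; Weil1964, Chap. III n° 37–40] -/
theorem prop311_CM_of_darbouxLeg (hn : Module.finrank L V = n)
    (hΦ₁ : ∀ (a : L) (x y : V), Φ (a • x) y = a * Φ x y)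
    (hΦ₂ : ∀ (a : L) (x y : V), Φ x (a • y) = Φ x y * IsCMField.complexConj L a)
    (hΦ₃ : ∀ x y : V, Φ y x = -IsCMField.complexConj L (Φ x y))
    (hφ : (traceForm (↥(maximalRealSubfield L)) L V Φ).Nondegenerate)
    (hρu : ∀ (h : AdelicHeisenberg (↥(maximalRealSubfield L)) L V Φ) (v : S), ‖ρ h v‖ = ‖v‖)
    (hρi : ∀ K : Submodule ℂ S, IsClosed (K : Set S) →
      (∀ (h : AdelicHeisenberg (↥(maximalRealSubfield L)) L V Φ), ∀ v ∈ K, ρ h v ∈ K) → K = ⊥ ∨ K = ⊤)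
    (e₀ : ((Fin n → AdeleRing (𝓞 ↥(maximalRealSubfield L)) ↥(maximalRealSubfield L)) ×
        (Fin n → AdeleRing (𝓞 ↥(maximalRealSubfield L)) ↥(maximalRealSubfield L))) ≃ₗ[
          AdeleRing (𝓞 ↥(maximalRealSubfield L)) ↥(maximalRealSubfield L)] AdelicSpace (↥(maximalRealSubfield L)) V)
    (he₀ : ∀ c c' : (Fin n → AdeleRing (𝓞 ↥(maximalRealSubfield L)) ↥(maximalRealSubfield L)) ×
        (Fin n → AdeleRing (𝓞 ↥(maximalRealSubfield L)) ↥(maximalRealSubfield L)),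
      adelicTraceForm (↥(maximalRealSubfield L)) L V Φ (e₀ c) (e₀ c') = c.1 ⬝ᵥ c'.2 - c'.1 ⬝ᵥ c.2)
    (φ₀ : adelicMpCont (↥(maximalRealSubfield L)) (Fin n)
        (1 : Matrix (Fin n) (Fin n) (AdeleRing (𝓞 ↥(maximalRealSubfield L)) ↥(maximalRealSubfield L))) →*
      adelicMp (↥(maximalRealSubfield L)) L V Φ ρ) (hφ₀ : Continuous φ₀)
    (hproj₀ : ∀ (m₁ : adelicMpCont (↥(maximalRealSubfield L)) (Fin n)
          (1 : Matrix (Fin n) (Fin n) (AdeleRing (𝓞 ↥(maximalRealSubfield L)) ↥(maximalRealSubfield L))))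
        (c : (Fin n → AdeleRing (𝓞 ↥(maximalRealSubfield L)) ↥(maximalRealSubfield L)) ×
          (Fin n → AdeleRing (𝓞 ↥(maximalRealSubfield L)) ↥(maximalRealSubfield L))),
      ((proj (↥(maximalRealSubfield L)) L V Φ ρ (φ₀ m₁) : adelicSp (↥(maximalRealSubfield L)) L V Φ) :
            AdelicSpace (↥(maximalRealSubfield L)) V ≃ₗ[AdeleRing (𝓞 ↥(maximalRealSubfield L)) ↥(maximalRealSubfield L)]
              AdelicSpace (↥(maximalRealSubfield L)) V) (e₀ c) =
        e₀ (((adelicMpCont.proj (↥(maximalRealSubfield L)) (Fin n)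
                (1 : Matrix (Fin n) (Fin n) (AdeleRing (𝓞 ↥(maximalRealSubfield L)) ↥(maximalRealSubfield L))) m₁ :
              symplecticGroup (polar (adelicForm (↥(maximalRealSubfield L)) (Fin n)
                (1 : Matrix (Fin n) (Fin n) (AdeleRing (𝓞 ↥(maximalRealSubfield L)) ↥(maximalRealSubfield L)))))) :
            ((Fin n → AdeleRing (𝓞 ↥(maximalRealSubfield L)) ↥(maximalRealSubfield L)) ×
                (Fin n → AdeleRing (𝓞 ↥(maximalRealSubfield L)) ↥(maximalRealSubfield L))) ≃ₗ[
                AdeleRing (𝓞 ↥(maximalRealSubfield L)) ↥(maximalRealSubfield L)]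
              ((Fin n → AdeleRing (𝓞 ↥(maximalRealSubfield L)) ↥(maximalRealSubfield L)) ×
                (Fin n → AdeleRing (𝓞 ↥(maximalRealSubfield L)) ↥(maximalRealSubfield L)))) c)) :
    (∃! i : ratSp (↥(maximalRealSubfield L)) L V Φ →* adelicMp (↥(maximalRealSubfield L)) L V Φ ρ,
        IsRationalSplitting (↥(maximalRealSubfield L)) L V Φ ρ i) ∧
      ∀ i : ratSp (↥(maximalRealSubfield L)) L V Φ →* adelicMp (↥(maximalRealSubfield L)) L V Φ ρ,
        IsRationalSplitting (↥(maximalRealSubfield L)) L V Φ ρ i →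
          ((∃ s : adelicUnitary (↥(maximalRealSubfield L)) L V Φ →* adelicMp (↥(maximalRealSubfield L)) L V Φ ρ,
              ∀ g : adelicUnitary (↥(maximalRealSubfield L)) L V Φ,
                projEnd (↥(maximalRealSubfield L)) L V Φ ρ (s g) =
                  ((g : AdelicSpace (↥(maximalRealSubfield L)) V ≃ₗ[AdeleRing (𝓞 ↥(maximalRealSubfield L)) ↥(maximalRealSubfield L)]
                      AdelicSpace (↥(maximalRealSubfield L)) V) :
                    AdelicSpace (↥(maximalRealSubfield L)) V →ₗ[AdeleRing (𝓞 ↥(maximalRealSubfield L)) ↥(maximalRealSubfield L)]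
                      AdelicSpace (↥(maximalRealSubfield L)) V)) ∧
            ∃ s : adelicUnitary (↥(maximalRealSubfield L)) L V Φ →* adelicMp (↥(maximalRealSubfield L)) L V Φ ρ,
              Continuous s ∧
              (∀ g : adelicUnitary (↥(maximalRealSubfield L)) L V Φ,
                projEnd (↥(maximalRealSubfield L)) L V Φ ρ (s g) =
                  ((g : AdelicSpace (↥(maximalRealSubfield L)) V ≃ₗ[AdeleRing (𝓞 ↥(maximalRealSubfield L)) ↥(maximalRealSubfield L)]
                      AdelicSpace (↥(maximalRealSubfield L)) V) :
                    AdelicSpace (↥(maximalRealSubfield L)) V →ₗ[AdeleRing (𝓞 ↥(maximalRealSubfield L)) ↥(maximalRealSubfield L)]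
                      AdelicSpace (↥(maximalRealSubfield L)) V)) ∧
              ∀ g : adelicUnitary (↥(maximalRealSubfield L)) L V Φ,
                IsRationalPoint (↥(maximalRealSubfield L)) L V Φ
                    (g : AdelicSpace (↥(maximalRealSubfield L)) V ≃ₗ[AdeleRing (𝓞 ↥(maximalRealSubfield L)) ↥(maximalRealSubfield L)]
                      AdelicSpace (↥(maximalRealSubfield L)) V) →
                  s g ∈ i.range) :=
  prop311_CM_of_darbouxLeg_of_proj_surjective L V Φ ρ hn hΦ₁ hΦ₂ hΦ₃ hφ hρu hρi
    (adelicMpCont.proj_one_surjective (↥(maximalRealSubfield L))) e₀ he₀ φ₀ hφ₀ hproj₀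

end CM

end Prop311

end Literature.NumberTheory.GelbartRogawski1991

end
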